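import Summits.Ventures.HodgeRepro2.BallQuotientMeasure
import Summits.Ventures.HodgeRepro2.BallQuotientFiniteCover

/-!
# The quotient measures of a finite cover `S'\𝔹² → S\𝔹²`: `π_* μ_{S'} = [S : S'] · μ_S`

Kernel support for the blind cell pub-hodge-repro2 (seat p2), T5-ID / row 40 (`T5CoveringIntegral.lean`),
which descended (N) along the tower of congruence quotients from the HYPOTHESIS
`Measure.map π μ' = d • μ` («the geometric input»).  Here that hypothesis is PROVED for the Bergman
quotient measures: for `S' ≤ S` of finite index `n`, a fundamental domain `D` of `S` yields the
fundamental domain `D' := ⋃_q (out q)⁻¹ • D` of `S'` (`q` over the cosets `S ⧸ S'`), and the finite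
cover `π : S'\𝔹² → S\𝔹²` of row 75 satisfies `π_* (quotientMeasure D') = n • quotientMeasure D`.
-/

namespace Summit.Ventures.HodgeRepro2.ShimuraData

open MeasureTheory
open scoped Pointwise

variable {K : Type*} [Field K] [NumberField K] [NumberField.IsCMField K]
    {τ₁ : K →+* ℂ} {H : Matrix (Fin 3) (Fin 3) K} {Q : Matrix (Fin 3) (Fin 3) ℂ}
    (hQ : IsFrame K τ₁ H Q) {S' S : Subgroup (GL (Fin 3) K)} (hS'S : S' ≤ S)
    (hS : (S : Set (GL (Fin 3) K)) ⊆ unitaryGroup K H)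

/-- The fundamental domain of `S'` built from a fundamental domain `D` of `S` and coset
representatives: `⋃_q (out q)⁻¹ • D`. -/
def cosetDomain (D : Set ball₂) : Set ball₂ :=
  letI := frameAction hQ S hS
  ⋃ q : S ⧸ S'.subgroupOf S, (Quotient.out q)⁻¹ • D

/-- The `S'`-action and the `S`-action agree on the ball. -/
theorem frameAction_smul_subgroup (γ : S') (z : ball₂) :
    letI := frameAction hQ S' (fun _ hγ => hS (hS'S hγ))
    letI := frameAction hQ S hS
    γ • z = (⟨(γ : GL (Fin 3) K), hS'S γ.property⟩ : S) • z := by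
  letI := frameAction hQ S' (fun _ hγ => hS (hS'S hγ))
  letI := frameAction hQ S hS
  apply Subtype.ext
  rw [frameAction_smul_coe, frameAction_smul_coe]

/-- **`cosetDomain D` is a fundamental domain of `S'`** when `D` is one of `S` (finite index). -/
theorem isBallFundamentalDomain_cosetDomain [hfi : (S'.subgroupOf S).FiniteIndex] {D : Set ball₂}
    (hDm : MeasurableSet D) (hD : IsBallFundamentalDomain hQ S hS D) :
    IsBallFundamentalDomain hQ S' (fun _ hγ => hS (hS'S hγ)) (cosetDomain hQ hS (S' := S') D) := by
  letI := frameAction hQ S' (fun _ hγ => hS (hS'S hγ))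
  letI instS := frameAction hQ S hS
  haveI : MeasurableConstSMul S ball₂ := measurableConstSMul_frameAction hQ S hS
  haveI : MeasurableConstSMul S' ball₂ := measurableConstSMul_frameAction hQ S' _
  haveI : SMulInvariantMeasure S ball₂ bergmanBall := smulInvariantMeasure_bergmanBall hQ S hS
  haveI : SMulInvariantMeasure S' ball₂ bergmanBall := smulInvariantMeasure_bergmanBall hQ S' _
  haveI : Finite (S ⧸ S'.subgroupOf S) := Subgroup.finite_quotient_of_finiteIndex
  haveI : Countable S := countable_subgroup_GL_of_numberField S
  unfold IsBallFundamentalDomain at hD ⊢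
  refine IsFundamentalDomain.mk'' ?_ ?_ ?_ ?_
  · exact (MeasurableSet.iUnion fun q => hDm.const_smul _).nullMeasurableSet
  · -- a.e. covering: `x = s⁻¹ • y` with `y ∈ D`, `s = (out ⟦s⟧) t⁻¹`, `t ∈ S'`
    filter_upwards [hD.ae_covers] with x hx
    obtain ⟨s, hs⟩ := hx
    obtain ⟨t, ht⟩ := QuotientGroup.mk_out_eq_mul (S'.subgroupOf S) s
    have ht' : ((t : S) : GL (Fin 3) K) ∈ S' := Subgroup.mem_subgroupOf.mp t.property
    refine ⟨⟨((t : S) : GL (Fin 3) K)⁻¹, S'.inv_mem ht'⟩, ?_⟩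
    rw [frameAction_smul_subgroup hQ hS'S hS]
    refine Set.mem_iUnion.mpr ⟨QuotientGroup.mk s, s • x, hs, ?_⟩
    show (Quotient.out (QuotientGroup.mk (s := S'.subgroupOf S) s))⁻¹ • (s • x) = _
    rw [ht, mul_inv_rev, mul_smul, inv_smul_smul]
    exact congrArg (· • x) (Subtype.ext rfl)
  · -- a.e. disjointness of `g • D'` and `D'` for `g ∈ S'`, `g ≠ 1`
    intro g hg
    unfold cosetDomain
    rw [Set.smul_set_iUnion, AEDisjoint.iUnion_left_iff]
    intro q
    rw [AEDisjoint.iUnion_right_iff]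
    intro q'
    have hg' : ∀ z : ball₂, g • z = (⟨(g : GL (Fin 3) K), hS'S g.property⟩ : S) • z :=
      fun z => frameAction_smul_subgroup hQ hS'S hS g z
    have hset : g • ((Quotient.out q)⁻¹ • D) =
        ((⟨(g : GL (Fin 3) K), hS'S g.property⟩ : S) * (Quotient.out q)⁻¹) • D := by
      rw [mul_smul]
      ext z
      simp only [Set.mem_smul_set, hg']
    rw [hset]
    refine hD.aedisjoint fun heq => hg ?_
    -- `g • (out q)⁻¹ = (out q')⁻¹` forces `q = q'` and `g = 1`
    have hmem : (⟨(g : GL (Fin 3) K), hS'S g.property⟩ : S) ∈ S'.subgroupOf S :=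
      Subgroup.mem_subgroupOf.mpr g.property
    have hqq : QuotientGroup.mk (s := S'.subgroupOf S) (Quotient.out q) = QuotientGroup.mk (Quotient.out q') := by
      rw [QuotientGroup.eq]
      have hq' : Quotient.out q' = Quotient.out q * (⟨(g : GL (Fin 3) K), hS'S g.property⟩ : S)⁻¹ := by
        rw [← inv_inv (Quotient.out q'), ← heq]
        group
      rw [hq']
      have : (Quotient.out q)⁻¹ * (Quotient.out q * (⟨(g : GL (Fin 3) K), hS'S g.property⟩ : S)⁻¹) =
          (⟨(g : GL (Fin 3) K), hS'S g.property⟩ : S)⁻¹ := by group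
      rw [this]
      exact (S'.subgroupOf S).inv_mem hmem
    rw [QuotientGroup.out_eq', QuotientGroup.out_eq'] at hqq
    subst hqq
    have h1 : (⟨(g : GL (Fin 3) K), hS'S g.property⟩ : S) = 1 := by
      have := heq
      rw [mul_inv_eq_iff_eq_mul, inv_mul_cancel] at this
      exact this
    apply Subtype.ext
    have h2 : ((⟨(g : GL (Fin 3) K), hS'S g.property⟩ : S) : GL (Fin 3) K) = ((1 : S) : GL (Fin 3) K) :=
      congrArg Subtype.val h1
    exact h2
  · intro g
    exact (measurePreserving_smul g bergmanBall).quasiMeasurePreserving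

/-- `π ∘ mk' = mk`. -/
theorem ballQuotientMap_comp_mk :
    ballQuotientMap hQ hS'S hS ∘ ballQuotient.mk hQ S' (fun _ hγ => hS (hS'S hγ)) =
      ballQuotient.mk hQ S hS :=
  funext fun z => ballQuotientMap_mk hQ hS'S hS z

/-- The finite cover `π : S'\𝔹² → S\𝔹²` is measurable. -/
theorem measurable_ballQuotientMap : Measurable (ballQuotientMap hQ hS'S hS) := by
  rw [measurable_from_quotient]
  exact measurable_ballQuotient_mk hQ S hS

/-- **`π_* μ_{S'} = [S : S'] · μ_S`** for the quotient measures built from `D` (for `S`) and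
`cosetDomain D` (for `S'`). -/
theorem map_ballQuotientMap_quotientMeasure_cosetDomain [hfi : (S'.subgroupOf S).FiniteIndex]
    {D : Set ball₂} (hDm : MeasurableSet D) (hD : IsBallFundamentalDomain hQ S hS D) :
    Measure.map (ballQuotientMap hQ hS'S hS)
        (quotientMeasure hQ S' (fun _ hγ => hS (hS'S hγ)) (cosetDomain hQ hS (S' := S') D)) =
      ((S'.subgroupOf S).index : ENNReal) • quotientMeasure hQ S hS D := by
  letI := frameAction hQ S hS
  haveI : MeasurableConstSMul S ball₂ := measurableConstSMul_frameAction hQ S hS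
  haveI : SMulInvariantMeasure S ball₂ bergmanBall := smulInvariantMeasure_bergmanBall hQ S hS
  haveI : Finite (S ⧸ S'.subgroupOf S) := Subgroup.finite_quotient_of_finiteIndex
  haveI : Fintype (S ⧸ S'.subgroupOf S) := Fintype.ofFinite _
  ext A hA
  rw [Measure.map_apply (measurable_ballQuotientMap hQ hS'S hS) hA, Measure.smul_apply, smul_eq_mul,
    quotientMeasure_apply hQ S' _ _ ((measurable_ballQuotientMap hQ hS'S hS) hA),
    quotientMeasure_apply hQ S hS D hA]
  have hpre : ballQuotient.mk hQ S' (fun _ hγ => hS (hS'S hγ)) ⁻¹' (ballQuotientMap hQ hS'S hS ⁻¹' A) =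
      ballQuotient.mk hQ S hS ⁻¹' A := by
    rw [← Set.preimage_comp, ballQuotientMap_comp_mk]
  rw [hpre]
  unfold cosetDomain
  have hAm : MeasurableSet (ballQuotient.mk hQ S hS ⁻¹' A) := measurable_ballQuotient_mk hQ S hS hA
  rw [Set.inter_iUnion, measure_iUnion₀ ?_ ?_]
  · have hterm : ∀ q : S ⧸ S'.subgroupOf S,
        bergmanBall (ballQuotient.mk hQ S hS ⁻¹' A ∩ (Quotient.out q)⁻¹ • D) =
          bergmanBall (ballQuotient.mk hQ S hS ⁻¹' A ∩ D) := fun q => by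
      rw [← measure_smul bergmanBall (Quotient.out q)⁻¹ (ballQuotient.mk hQ S hS ⁻¹' A ∩ D),
        Set.smul_set_inter]
      congr 2
      ext z
      rw [Set.mem_smul_set_iff_inv_smul_mem, inv_inv]
      exact (smul_mem_preimage_mk_iff hQ S hS A _ z).symm
    simp_rw [hterm]
    rw [tsum_fintype, Finset.sum_const, Finset.card_univ, nsmul_eq_mul, Subgroup.index_eq_card,
      Nat.card_eq_fintype_card]
  · intro q q' hqq'
    have hne : (Quotient.out q)⁻¹ ≠ (Quotient.out q')⁻¹ := fun h => hqq' (by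
      have h' := inv_injective h
      rw [← QuotientGroup.out_eq' q, ← QuotientGroup.out_eq' q', h'])
    exact (hD.aedisjoint hne).mono Set.inter_subset_right Set.inter_subset_right
  · intro q
    exact (hAm.inter (hDm.const_smul _)).nullMeasurableSet

end Summit.Ventures.HodgeRepro2.ShimuraData
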